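import Summits.ValiantsHypothesis.Statement
import Literature.Computability.AlgebraicComplexity.TavenasDepthFourProofs
import Literature.Computability.AlgebraicComplexity.ValiantConjectureProofs
import Literature.Computability.AlgebraicComplexity.StandardFamiliesProofs
import HarnessLib
import HarnessLib.Audit

/-!
# Depth-4 chasm for the permanent: the SIZE COUPLING of Tavenas' bound is `√a`, in the kernel

Helper theorems for route `Depth4` (crux `Depth4HomFour`), lens-4 (depth-reduction / chasm axis) of
the `decomp-valiant` workshop, generation 21 (called offer O15-CORE).  Sorry-free; no `def` at all
(exponents are written out); no Literature fact is added; no route file is imported.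

## What is proved (new: the arithmetic `sizeBound_le_balanced`; the construction is the tree's)

The tree's `DepthReduction.homDepthFourCircuitSize_le_of_isVPFamily` runs Tavenas' reduction with
bottom degree `t = ⌊√d⌋` and pays `s^{16d/(t+1)}` for a size-`s` circuit, whence its `√d`-coefficient
`48(a₁+a₂+a+2)+32` (and `50(…)+40` additively) — LINEAR in the size exponent `a` (`s ≤ B^a`).  The
tree's construction `DepthReduction.exists_depthFour_circuit_of_slp` is parametric in `t`; choosing the
BALANCED bottom degree `t + 1 = (⌊√a⌋+1)(⌊√d⌋+1)` (Tavenas 2015, the Corollary to Thm. 1: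
`2^{O(√(d·log(ds)·log N))}`; Landsberg 2017 Thm. 7.5.2.1) trades the sparsity term `(N+t)^t` against
`s^{16d/(t+1)}` and gives, for ONE homogeneous polynomial `g` over any commutative semiring
(`homDepthFourCircuitSize_le_balanced`):

  `#vars ≤ B^{a₁}`, `deg g + 1 ≤ B^{a₂}`, `L(g) ≤ B^{a}`, `B ≥ max(2, ⌊√a⌋+1)`  ⟹
  `homDepthFourCircuitSize g ≤ B ^ ((((a₁+a₂+18)(⌊√a⌋+1) + 32a₂ + 16)(⌊√(deg g)⌋+1) + 2a₂ + 8)`.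

For the permanent (`a₁ = 2`, `a₂ = 1`; `homDepthFourCircuitSize_per_le`): if `L(per_n) ≤ (n+2)^a` and
`n + 2 ≥ ⌊√a⌋ + 1` then `homDepthFourCircuitSize per_n ≤ (n+2)^{(21(⌊√a⌋+1)+48)(⌊√n⌋+1)+10}`.

## The exchange rate it certifies (pointwise in `n`)

A homogeneous-depth-4 lower bound `homDepthFourCircuitSize per_n > (n+2)^{(21(k+1)+48)(⌊√n⌋+1)+10}`
at one `n ≥ k - 1` certifies `L(per_n) > (n+2)^{a}` for every `a < (k+1)²` at that `n`
(`complexity_per_gt_of_depthFour_gt`; in route `Depth4`'s exact currency `(n+2 : ℕ∞)^(c⌊√n⌋+c)`: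
`c = 21⌊√a⌋ + 79` certifies exponent `a`, `complexity_per_gt_of_depth4HomFour_rung`; the tree's
constants need `c = 50a + 290`).  Infinitely many such `n` give `per ∉ size (n+2)^{a}` i.o.
(`complexity_per_gt_io_of_depthFour_gt_io`, the `A_a` currency of the costume census rows H5/H14), and
rungs for every `a` give `VP ≠ VNP` (`vh_of_balanced_rungs`; this is route `Depth4`'s `closes` re-run
with the balanced constants, recorded for the bookkeeping only).

## The coupling dial (exponent `θ` of `a` in the `√d`-coefficient of the chasm, `per`'s regime)

* `θ = 1`   — the tree's kernel constant `(48a+272)⌊√n⌋ + 50a+290` (`homDepthFourCircuitSize_le_of_isVPFamily`);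
* `θ = ½`   — THIS FILE (kernel) = print (Tavenas 2015 Cor.; Landsberg 2017 Thm. 7.5.2.1);
* `θ = 0`   — a size-UNIFORM reduction (`(n+2)^{K·a+K+c₀(⌊√n⌋+1)}`), behind which a FIXED-slope rung
  would close `VH`, is open in print in the `n²`-variable regime (Kumar–Saraf 2017 Cor. 1.3 refutes
  scale-improved reductions only via `IMM_{n^c,n}`, `n^{2c+1}` variables); recorded at paper level in the
  workshop node only — not typed here, no kernel decision.

USES (by name, no copies): `DepthReduction.exists_depthFour_circuit_of_slp`, `DepthReduction.sizeBound`,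
`DepthReduction.exists_slp`, `DepthReduction.le_two_mul_pow`, `ArithCircuit.exists_computes_size_eq_complexity`,
`homDepthFourCircuitSize_le`, `totalDegree_perPoly_holds`, `perPoly_isHomogeneous`,
`mem_VP_ofFintype_iff_holds`, `perFamily_mem_VNP_holds`.
-/

noncomputable section

open MvPolynomial

set_option linter.dupNamespace false

namespace Summit.ValiantsHypothesis.ValiantsHypothesis.Theorems.Depth4SizeCoupling

open Literature.Computability.AlgebraicComplexity
open Literature.Computability.AlgebraicComplexity.DepthReduction

universe u v

/-! ### §1 The balanced arithmetic -/

/-- Four terms each at most `B^X` sum, with `+1`, to at most `B^(X+2)` (`B ≥ 2`). [folklore] -/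
theorem add_three_add_one_le_pow {B X T₁ T₂ T₃ : ℕ} (hB : 2 ≤ B) (h₁ : T₁ ≤ B ^ X)
    (h₂ : T₂ ≤ B ^ X) (h₃ : T₃ ≤ B ^ X) : T₁ + T₂ + T₃ + 1 ≤ B ^ (X + 2) := by
  have hX : 1 ≤ B ^ X := Nat.one_le_pow _ _ (by omega)
  have h4 : 4 ≤ B ^ 2 := by
    have : 2 ^ 2 ≤ B ^ 2 := Nat.pow_le_pow_left hB 2
    simpa using this
  calc T₁ + T₂ + T₃ + 1 ≤ 4 * B ^ X := by omega
    _ ≤ B ^ 2 * B ^ X := Nat.mul_le_mul_right _ h4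
    _ = B ^ (X + 2) := by ring

/-- **The balanced size bound.** With `t + 1 = r · u`, `a < r²`, `d < u²`, `u ≤ d + 1`, `r ≤ B`:
`sizeBound N d s t ≤ B ^ ((a₁+a₂+2)·(r·u) + (16r + 32a₂ + 16)·u + 2a₂ + 8)`.
The quotient `8d/(t+1) ≤ 8u/r` carries the `s`-dependence `(16 s²(d+1)⁴)^{8d/(t+1)} ≤ B^{(16r+32a₂+16)u}`
(using `2a + 4 ≤ 2r² + 2`), and `(N+t)^t ≤ B^{(a₁+a₂+2)(t+1)}` (using `r ≤ B`).
[cite: Tavenas2015, Thm. 1 and its Corollary (balanced parameters)] -/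
theorem sizeBound_le_balanced {B a₁ a₂ a N d s r u t : ℕ} (hB : 2 ≤ B) (hrB : r ≤ B)
    (har : a < r * r) (hu : 1 ≤ u) (hdu : d < u * u) (hud : u ≤ d + 1)
    (ht : t + 1 = r * u) (hN : N ≤ B ^ a₁) (hd : d + 1 ≤ B ^ a₂) (hs : s ≤ B ^ a) :
    sizeBound N d s t ≤
      B ^ ((a₁ + a₂ + 2) * (r * u) + (16 * r + 32 * a₂ + 16) * u + 2 * a₂ + 8) := by
  have hB0 : 0 < B := by omega
  -- the quotient `q = 8d/(t+1) ≤ 8u/r ≤ 8u`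
  have hq : 8 * d / (t + 1) ≤ 8 * u / r := by
    rw [ht]
    calc 8 * d / (r * u) ≤ 8 * u * u / (r * u) := by
          apply Nat.div_le_div_right
          have := Nat.mul_le_mul_left 8 hdu.le
          simpa [mul_assoc] using this
      _ = 8 * u / r := Nat.mul_div_mul_right (8 * u) r (by omega)
  have hq8 : 8 * d / (t + 1) ≤ 8 * u := hq.trans (Nat.div_le_self _ _)
  -- the exponent carrying `s`
  have hE : (2 * a + 4 * a₂ + 4) * (8 * d / (t + 1)) ≤ (16 * r + 32 * a₂ + 16) * u := by
    have hw1 : r * (8 * u / r) ≤ 8 * u := Nat.mul_div_le (8 * u) r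
    have hw2 : 8 * u / r ≤ 8 * u := Nat.div_le_self _ _
    have h2a : 2 * a + 4 * a₂ + 4 ≤ 2 * (r * r) + 4 * a₂ + 2 := by omega
    calc (2 * a + 4 * a₂ + 4) * (8 * d / (t + 1))
        ≤ (2 * (r * r) + 4 * a₂ + 2) * (8 * u / r) := Nat.mul_le_mul h2a hq
      _ = 2 * r * (r * (8 * u / r)) + (4 * a₂ + 2) * (8 * u / r) := by ring
      _ ≤ 2 * r * (8 * u) + (4 * a₂ + 2) * (8 * u) :=
          add_le_add (Nat.mul_le_mul_left _ hw1) (Nat.mul_le_mul_left _ hw2)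
      _ = (16 * r + 32 * a₂ + 16) * u := by ring
  -- the base `M = (4 s (d+1)²)² ≤ B^(2a+4a₂+4)`
  have h4 : 4 ≤ B ^ 2 := by
    have : 2 ^ 2 ≤ B ^ 2 := Nat.pow_le_pow_left hB 2
    simpa using this
  have hone : 4 * s * (d + 1) ^ 2 ≤ B ^ (a + 2 * a₂ + 2) := by
    calc 4 * s * (d + 1) ^ 2 ≤ B ^ 2 * B ^ a * (B ^ a₂) ^ 2 :=
          Nat.mul_le_mul (Nat.mul_le_mul h4 hs) (Nat.pow_le_pow_left hd 2)
      _ = B ^ (a + 2 * a₂ + 2) := by ring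
  have hM : 4 * s * (d + 1) ^ 2 * (4 * s * (d + 1) ^ 2) ≤ B ^ (2 * a + 4 * a₂ + 4) := by
    calc 4 * s * (d + 1) ^ 2 * (4 * s * (d + 1) ^ 2)
        ≤ B ^ (a + 2 * a₂ + 2) * B ^ (a + 2 * a₂ + 2) := Nat.mul_le_mul hone hone
      _ = B ^ (2 * a + 4 * a₂ + 4) := by ring
  have hMq : (4 * s * (d + 1) ^ 2 * (4 * s * (d + 1) ^ 2)) ^ (8 * d / (t + 1)) ≤
      B ^ ((16 * r + 32 * a₂ + 16) * u) := by
    calc (4 * s * (d + 1) ^ 2 * (4 * s * (d + 1) ^ 2)) ^ (8 * d / (t + 1))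
        ≤ (B ^ (2 * a + 4 * a₂ + 4)) ^ (8 * d / (t + 1)) := Nat.pow_le_pow_left hM _
      _ = B ^ ((2 * a + 4 * a₂ + 4) * (8 * d / (t + 1))) := by rw [← pow_mul]
      _ ≤ B ^ ((16 * r + 32 * a₂ + 16) * u) := Nat.pow_le_pow_right hB0 hE
  -- the small factors
  have h64 : 64 ≤ B ^ 6 := by
    have : 2 ^ 6 ≤ B ^ 6 := Nat.pow_le_pow_left hB 6
    simpa using this
  have h14 : 1 + 4 * (8 * d / (t + 1)) ≤ B ^ (a₂ + 6) := by
    calc 1 + 4 * (8 * d / (t + 1)) ≤ 33 * u := by omega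
      _ ≤ 33 * (d + 1) := Nat.mul_le_mul_left _ hud
      _ ≤ 64 * B ^ a₂ := Nat.mul_le_mul (by norm_num) hd
      _ ≤ B ^ 6 * B ^ a₂ := Nat.mul_le_mul_right _ h64
      _ = B ^ (a₂ + 6) := by ring
  -- the sparsity term `(t+1)(N+t)^t`
  have htB : t + 1 ≤ B ^ (a₂ + 1) := by
    rw [ht]
    calc r * u ≤ B * (d + 1) := Nat.mul_le_mul hrB hud
      _ ≤ B * B ^ a₂ := Nat.mul_le_mul_left _ hd
      _ = B ^ (a₂ + 1) := by ring
  have hNt : N + t ≤ B ^ (a₁ + a₂ + 2) := by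
    have h1 : B ^ a₁ ≤ B ^ (a₁ + a₂ + 1) := Nat.pow_le_pow_right hB0 (by omega)
    have h2 : B ^ (a₂ + 1) ≤ B ^ (a₁ + a₂ + 1) := Nat.pow_le_pow_right hB0 (by omega)
    calc N + t ≤ B ^ a₁ + B ^ (a₂ + 1) := by omega
      _ ≤ 2 * B ^ (a₁ + a₂ + 1) := by omega
      _ ≤ B * B ^ (a₁ + a₂ + 1) := Nat.mul_le_mul_right _ hB
      _ = B ^ (a₁ + a₂ + 2) := by ring
  have hT1 : (t + 1) * (N + t) ^ t ≤ B ^ ((a₁ + a₂ + 2) * (r * u) + a₂ + 1) := by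
    calc (t + 1) * (N + t) ^ t ≤ B ^ (a₂ + 1) * (B ^ (a₁ + a₂ + 2)) ^ (r * u) := by
          refine Nat.mul_le_mul htB ?_
          calc (N + t) ^ t ≤ (B ^ (a₁ + a₂ + 2)) ^ t := Nat.pow_le_pow_left hNt t
            _ ≤ (B ^ (a₁ + a₂ + 2)) ^ (r * u) :=
                Nat.pow_le_pow_right (Nat.pow_pos hB0) (by omega)
      _ = B ^ ((a₁ + a₂ + 2) * (r * u) + a₂ + 1) := by rw [← pow_mul]; ring
  -- assemble
  set X : ℕ := (a₁ + a₂ + 2) * (r * u) + (16 * r + 32 * a₂ + 16) * u + 2 * a₂ + 6 with hX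
  have hX1 : (a₁ + a₂ + 2) * (r * u) + a₂ + 1 ≤ X := by rw [hX]; omega
  have hX2 : a₂ + (16 * r + 32 * a₂ + 16) * u + (a₂ + 6) ≤ X := by rw [hX]; omega
  have hX3 : a₂ + (16 * r + 32 * a₂ + 16) * u ≤ X := by rw [hX]; omega
  have hT1' : (t + 1) * (N + t) ^ t ≤ B ^ X := hT1.trans (Nat.pow_le_pow_right hB0 hX1)
  have hT2' : (d + 1) * (4 * s * (d + 1) ^ 2 * (4 * s * (d + 1) ^ 2)) ^ (8 * d / (t + 1)) *
      (1 + 4 * (8 * d / (t + 1))) ≤ B ^ X := by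
    calc (d + 1) * (4 * s * (d + 1) ^ 2 * (4 * s * (d + 1) ^ 2)) ^ (8 * d / (t + 1)) *
          (1 + 4 * (8 * d / (t + 1)))
        ≤ B ^ a₂ * B ^ ((16 * r + 32 * a₂ + 16) * u) * B ^ (a₂ + 6) :=
          Nat.mul_le_mul (Nat.mul_le_mul hd hMq) h14
      _ = B ^ (a₂ + (16 * r + 32 * a₂ + 16) * u + (a₂ + 6)) := by rw [← pow_add, ← pow_add]
      _ ≤ B ^ X := Nat.pow_le_pow_right hB0 hX2
  have hT3' : (d + 1) * (4 * s * (d + 1) ^ 2 * (4 * s * (d + 1) ^ 2)) ^ (8 * d / (t + 1)) ≤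
      B ^ X := by
    calc (d + 1) * (4 * s * (d + 1) ^ 2 * (4 * s * (d + 1) ^ 2)) ^ (8 * d / (t + 1))
        ≤ B ^ a₂ * B ^ ((16 * r + 32 * a₂ + 16) * u) := Nat.mul_le_mul hd hMq
      _ = B ^ (a₂ + (16 * r + 32 * a₂ + 16) * u) := by rw [← pow_add]
      _ ≤ B ^ X := Nat.pow_le_pow_right hB0 hX3
  have hfin := add_three_add_one_le_pow hB hT1' hT2' hT3'
  have hXe : X + 2 = (a₁ + a₂ + 2) * (r * u) + (16 * r + 32 * a₂ + 16) * u + 2 * a₂ + 8 := by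
    rw [hX]
  rw [sizeBound, ← hXe]
  exact hfin

/-! ### §2 The balanced depth-4 bound for one homogeneous polynomial -/

section OnePoly

variable {k : Type u} [CommSemiring k] {σ : Type v} [Fintype σ] [DecidableEq σ]

/-- **Tavenas' depth-4 reduction with balanced bottom degree (size coupling `√a`).** For a
homogeneous `g` over any commutative semiring with `#vars ≤ B^{a₁}`, `deg g + 1 ≤ B^{a₂}`,
`L(g) ≤ B^{a}` and `B ≥ max(2, ⌊√a⌋+1)`:
`homDepthFourCircuitSize g ≤ B^{(((a₁+a₂+18)(⌊√a⌋+1) + 32a₂ + 16)(⌊√deg g⌋+1) + 2a₂ + 8)}`.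
[cite: Tavenas2015, Thm. 1 and Corollary; AgrawalVinay2008; KumarSaraf2017, §3] -/
theorem homDepthFourCircuitSize_le_balanced (g : MvPolynomial σ k)
    (hgh : g.IsHomogeneous g.totalDegree) {B a₁ a₂ a : ℕ} (hB : 2 ≤ B)
    (hrB : Nat.sqrt a + 1 ≤ B) (hN : Fintype.card σ ≤ B ^ a₁)
    (hd : g.totalDegree + 1 ≤ B ^ a₂) (hs : complexity g ≤ B ^ a) :
    homDepthFourCircuitSize g ≤
      ((B ^ ((((a₁ + a₂ + 18) * (Nat.sqrt a + 1) + 32 * a₂ + 16) * (Nat.sqrt g.totalDegree + 1)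
        + 2 * a₂ + 8)) : ℕ) : ℕ∞) := by
  classical
  set d := g.totalDegree with hdd
  -- it suffices to build a homogeneous depth-4 circuit of the right size
  suffices hC : ∃ C : ArithCircuit k σ, C.eval = g ∧ C.IsDepthFour ∧ C.IsHomogeneousCircuit ∧
      C.size ≤ B ^ ((((a₁ + a₂ + 18) * (Nat.sqrt a + 1) + 32 * a₂ + 16) * (Nat.sqrt d + 1)
        + 2 * a₂ + 8)) by
    obtain ⟨C, hCe, hCd, hCh, hCs⟩ := hC
    refine (homDepthFourCircuitSize_le hCe hCd hCh).trans ?_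
    exact_mod_cast hCs
  by_cases hd0 : d = 0
  · refine ⟨ArithCircuit.ofConst (g.coeff 0), ?_, ArithCircuit.isDepthFour_ofConst _,
      ArithCircuit.isHomogeneousCircuit_ofConst _, ?_⟩
    · rw [ArithCircuit.eval_ofConst]; exact (totalDegree_eq_zero_iff_eq_C.1 hd0).symm
    · rw [ArithCircuit.size_ofConst]; exact Nat.zero_le _
  -- parameters: `r = ⌊√a⌋+1`, `u = ⌊√d⌋+1`, `t + 1 = r u`
  set r := Nat.sqrt a + 1 with hr
  set u := Nat.sqrt d + 1 with hu
  have hu2 : 2 ≤ u := by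
    have : 1 ≤ Nat.sqrt d := by rw [Nat.le_sqrt]; omega
    omega
  have hru : 2 ≤ r * u := by nlinarith
  set t := r * u - 1 with htdef
  have ht1 : t + 1 = r * u := by omega
  have ht : 1 ≤ t := by omega
  obtain ⟨P, hfan, hcomp, hsize⟩ := ArithCircuit.exists_computes_size_eq_complexity g
  obtain ⟨S, hlen, hcases⟩ := exists_slp P hfan
  rw [show P.eval = g from hcomp] at hcases
  rcases hcases with ⟨i, hi, hgi⟩ | ⟨j, hgj⟩ | ⟨c, hgc⟩
  · have hdi : (S.val i).IsHomogeneous d := by rw [← hgi]; exact hgh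
    obtain ⟨C, hCe, hCd, hCh, hCs⟩ := exists_depthFour_circuit_of_slp S hi hdi ht
    refine ⟨C, hCe.trans hgi.symm, hCd, hCh, hCs.trans ?_⟩
    have hsl : S.len ≤ B ^ a := by rw [hlen, hsize]; exact hs
    have har : a < r * r := Nat.lt_succ_sqrt a
    have hdu : d < u * u := Nat.lt_succ_sqrt d
    have hud : u ≤ d + 1 := by have := Nat.sqrt_le_self d; omega
    have key := sizeBound_le_balanced (a₁ := a₁) (a₂ := a₂) (N := Fintype.card σ) (d := d)
      (s := S.len) hB hrB har (by omega) hdu hud ht1 hN hd hsl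
    have hX : (a₁ + a₂ + 2) * (r * u) + (16 * r + 32 * a₂ + 16) * u + 2 * a₂ + 8 =
        ((a₁ + a₂ + 18) * r + 32 * a₂ + 16) * u + 2 * a₂ + 8 := by ring
    rw [hX] at key
    exact key
  · refine ⟨ArithCircuit.ofVar j, ?_, ArithCircuit.isDepthFour_ofVar _,
      ArithCircuit.isHomogeneousCircuit_ofVar _, ?_⟩
    · rw [ArithCircuit.eval_ofVar, hgj]
    · rw [ArithCircuit.size_ofVar]; exact Nat.zero_le _
  · refine ⟨ArithCircuit.ofConst c, ?_, ArithCircuit.isDepthFour_ofConst _,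
      ArithCircuit.isHomogeneousCircuit_ofConst _, ?_⟩
    · rw [ArithCircuit.eval_ofConst, hgc]
    · rw [ArithCircuit.size_ofConst]; exact Nat.zero_le _

end OnePoly

/-! ### §3 The permanent: pointwise exchange rate depth-4 ↔ general circuits -/

/-- **Balanced chasm for the permanent, pointwise in `n`.** If `L(per_n) ≤ (n+2)^a` and
`n + 2 ≥ ⌊√a⌋ + 1` then `homDepthFourCircuitSize per_n ≤ (n+2)^{(21(⌊√a⌋+1)+48)(⌊√n⌋+1)+10}`
(`a₁ = 2`: `n² ≤ (n+2)²`; `a₂ = 1`: `n + 1 ≤ n + 2`). The tree's family-level constant at the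
same data is `(50(a+5)+40)(⌊√n⌋+1)`. [cite: Tavenas2015, Thm. 1 and Corollary] -/
theorem homDepthFourCircuitSize_per_le {a n : ℕ} (hrB : Nat.sqrt a + 1 ≤ n + 2)
    (hs : complexity (perPoly (Fin n) ℂ) ≤ (n + 2) ^ a) :
    homDepthFourCircuitSize (perPoly (Fin n) ℂ) ≤
      (((n + 2) ^ ((21 * (Nat.sqrt a + 1) + 48) * (Nat.sqrt n + 1) + 10) : ℕ) : ℕ∞) := by
  have hdeg : (perPoly (Fin n) ℂ).totalDegree = n := by
    rw [totalDegree_perPoly_holds (n := Fin n) (k := ℂ), Fintype.card_fin]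
  have hgh : (perPoly (Fin n) ℂ).IsHomogeneous (perPoly (Fin n) ℂ).totalDegree := by
    rw [hdeg]; simpa only [Fintype.card_fin] using (perPoly_isHomogeneous (n := Fin n) (k := ℂ))
  have hN : Fintype.card (Fin n × Fin n) ≤ (n + 2) ^ 2 := by
    simp only [Fintype.card_prod, Fintype.card_fin]; nlinarith
  have hd : (perPoly (Fin n) ℂ).totalDegree + 1 ≤ (n + 2) ^ 1 := by rw [hdeg, pow_one]; omega
  have h := homDepthFourCircuitSize_le_balanced (B := n + 2) (a₁ := 2) (a₂ := 1) (a := a)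
    (perPoly (Fin n) ℂ) hgh (by omega) hrB hN hd hs
  rw [hdeg] at h
  have hX : ((2 + 1 + 18) * (Nat.sqrt a + 1) + 32 * 1 + 16) * (Nat.sqrt n + 1) + 2 * 1 + 8 =
      (21 * (Nat.sqrt a + 1) + 48) * (Nat.sqrt n + 1) + 10 := by ring
  exact h.trans (by exact_mod_cast Nat.pow_le_pow_right (by omega) hX.le)

/-- **Exchange rate (pointwise contrapositive).** A depth-4 lower bound for `per_n` beyond the
balanced threshold at `a` certifies `L(per_n) > (n+2)^a` at the same `n`. [folklore] -/
theorem complexity_per_gt_of_depthFour_gt {a n : ℕ} (hrB : Nat.sqrt a + 1 ≤ n + 2)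
    (h : (((n + 2) ^ ((21 * (Nat.sqrt a + 1) + 48) * (Nat.sqrt n + 1) + 10) : ℕ) : ℕ∞) <
      homDepthFourCircuitSize (perPoly (Fin n) ℂ)) :
    (n + 2) ^ a < complexity (perPoly (Fin n) ℂ) := by
  by_contra hle
  exact absurd (lt_of_lt_of_le h (homDepthFourCircuitSize_per_le hrB (not_lt.1 hle))) (lt_irrefl _)

/-- **In the route's exact currency** (`Depth4HomFour`: `(n+2 : ℕ∞)^(c·⌊√n⌋ + c) < homDepthFourCircuitSize per_n`):
the instance `c = 21(⌊√a⌋+1) + 58` of the crux's rung at one `n ≥ ⌊√a⌋ - 1` certifies `L(per_n) > (n+2)^a`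
there (`(21(⌊√a⌋+1)+48)(⌊√n⌋+1)+10 ≤ c⌊√n⌋ + c`).  Tree constants need `c = 50a + 290` for the same
conclusion. [cite: Tavenas2015, Thm. 1 and Corollary] -/
theorem complexity_per_gt_of_depth4HomFour_rung {a n : ℕ} (hrB : Nat.sqrt a + 1 ≤ n + 2)
    (h : (n + 2 : ℕ∞) ^ ((21 * (Nat.sqrt a + 1) + 58) * Nat.sqrt n + (21 * (Nat.sqrt a + 1) + 58)) <
      homDepthFourCircuitSize (perPoly (Fin n) ℂ)) :
    (n + 2) ^ a < complexity (perPoly (Fin n) ℂ) := by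
  refine complexity_per_gt_of_depthFour_gt hrB (lt_of_le_of_lt ?_ h)
  have hexp : (21 * (Nat.sqrt a + 1) + 48) * (Nat.sqrt n + 1) + 10 ≤
      (21 * (Nat.sqrt a + 1) + 58) * Nat.sqrt n + (21 * (Nat.sqrt a + 1) + 58) := by
    nlinarith [Nat.zero_le (Nat.sqrt n), Nat.zero_le (Nat.sqrt a)]
  have h1 : (1 : ℕ∞) ≤ (n + 2 : ℕ∞) := by
    have : ((1 : ℕ) : ℕ∞) ≤ ((n + 2 : ℕ) : ℕ∞) := by exact_mod_cast (by omega : 1 ≤ n + 2)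
    simpa using this
  calc (((n + 2) ^ ((21 * (Nat.sqrt a + 1) + 48) * (Nat.sqrt n + 1) + 10) : ℕ) : ℕ∞)
      = (n + 2 : ℕ∞) ^ ((21 * (Nat.sqrt a + 1) + 48) * (Nat.sqrt n + 1) + 10) := by
        push_cast; try rfl
    _ ≤ (n + 2 : ℕ∞) ^ ((21 * (Nat.sqrt a + 1) + 58) * Nat.sqrt n + (21 * (Nat.sqrt a + 1) + 58)) :=
        pow_le_pow_right₀ h1 hexp

/-- **`A_a` currency (census rows H5/H14): an i.o. homogeneous-depth-4 rung at the balanced slope for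
`a` gives `per ∉ size (n+2)^{a}` infinitely often.** [folklore] [cite: Tavenas2015, Thm. 1 and Corollary] -/
theorem complexity_per_gt_io_of_depthFour_gt_io {a : ℕ}
    (h : ∀ N₀ : ℕ, ∃ n : ℕ, N₀ ≤ n ∧
      (((n + 2) ^ ((21 * (Nat.sqrt a + 1) + 48) * (Nat.sqrt n + 1) + 10) : ℕ) : ℕ∞) <
        homDepthFourCircuitSize (perPoly (Fin n) ℂ)) :
    ∀ N₀ : ℕ, ∃ n : ℕ, N₀ ≤ n ∧ (n + 2) ^ a < complexity (perPoly (Fin n) ℂ) := by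
  intro N₀
  obtain ⟨n, hn, hlt⟩ := h (max N₀ (Nat.sqrt a))
  exact ⟨n, le_trans (le_max_left _ _) hn,
    complexity_per_gt_of_depthFour_gt (by have := le_trans (le_max_right _ _) hn; omega) hlt⟩

/-- **Graded rungs ⟹ `VH` (balanced constants).** If for every `a` some `n ≥ ⌊√(a+1)⌋ - 1` has
`homDepthFourCircuitSize per_n > (n+2)^{(21(⌊√(a+1)⌋+1)+48)(⌊√n⌋+1)+10}`, then `VP ≠ VNP`
(`L(per_n) ≤ n^a + a ≤ 2(n+2)^a ≤ (n+2)^{a+1}`); route `Depth4`'s `closes` re-run with the balanced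
constants. [cite: Tavenas2015, Thm. 1] [cite: Valiant1979] [cite: Burgisser2000, Thm. 2.10] -/
theorem vh_of_balanced_rungs
    (h : ∀ a : ℕ, ∃ n : ℕ, Nat.sqrt (a + 1) + 1 ≤ n + 2 ∧
      (((n + 2) ^ ((21 * (Nat.sqrt (a + 1) + 1) + 48) * (Nat.sqrt n + 1) + 10) : ℕ) : ℕ∞) <
        homDepthFourCircuitSize (perPoly (Fin n) ℂ)) :
    _root_.ValiantsHypothesis := by
  show VP ℂ ≠ VNP ℂ
  intro hEq
  have hVNP := perFamily_mem_VNP_holds ℂ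
  have hVP : perFamily ℂ ∈ VP ℂ := by rw [hEq]; exact hVNP
  have hfam : IsVPFamily (fun n => perPoly (Fin n) ℂ) := (mem_VP_ofFintype_iff_holds _).1 hVP
  obtain ⟨-, ⟨a, ha⟩⟩ := hfam
  obtain ⟨n, hrB, hlt⟩ := h a
  have hs : complexity (perPoly (Fin n) ℂ) ≤ (n + 2) ^ (a + 1) := by
    have h2 : complexity (perPoly (Fin n) ℂ) ≤ 2 * (n + 2) ^ a := le_two_mul_pow (ha n) le_rfl
    calc complexity (perPoly (Fin n) ℂ) ≤ 2 * (n + 2) ^ a := h2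
      _ ≤ (n + 2) * (n + 2) ^ a := Nat.mul_le_mul_right _ (by omega)
      _ = (n + 2) ^ (a + 1) := by ring
  exact absurd (complexity_per_gt_of_depthFour_gt hrB hlt) (not_lt.2 hs)

end Summit.ValiantsHypothesis.ValiantsHypothesis.Theorems.Depth4SizeCoupling

end
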